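import Summits.QuantumFields.YangMills.Theorems.BalabanLadderUVSeamRecClassicalResponseGlue
import HarnessLib

/-!
# Crux `UVSeamRec` (stmt-QuantumFields-20043), line `coldwall_pure`: the binder (EM_Q) «CARRIER EXPONENTIAL MOMENTS» — what the line actually
# consumes of its second measure-side stub `stub_gaussianDomination`

Definitions file (`--supports stmt-QuantumFields-20043`) of the LEAD seat `ym-spine-20043-p1` (gen 17); two named `Prop`s, no theorem of substance.

WHY.  The registered skeleton (RESHAPE 2, sha `c86db84aa426ab4c`) posits `stub_gaussianDomination : GaussianDominationSU2` — the extensive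
sub-Gaussian law in LINEAR sources of `√carrierCl` (`EMLin`).  The composition consumes it only through
(a) the doubled joint exponential moments (EM_Q) of the carriers of cyclically `2R+4`-separated cubes — hypothesis `hEMQ` of the (RM) press
`responseMoments_of_quadratic_and_influence` (p541348), produced from (EM_lin) by Hubbard–Stratonovich (`emQ_of_subGaussianLinear`) inside
`responseMomentsOdd6SU2_of_backgroundField_and_gaussianDomination` — and (b) the carrier MEAN (LEAD g16, `dirichletRate_of_coldWallSplit_of_carrierMean`,
for (DR)).  (b) follows from (a) by Jensen.  So the honest binder is (EM_Q) with SOME carrier constant `C` and SOME budget `B`: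

* `CarrierExpMoments C B β₁ ℓ₁` — for `β ≥ β₁`, every odd torus `(ℤ/(2L+1))⁴`, `1 ≤ R`, `R·uRec β ≤ ℓ₁`, `4R+8 ≤ L`, every cyclically
  `2R+4`-separated family `(q i, x i)` and every `T`: `⟨exp(2 Σ_{i∈T} carrierCl C 1 β R (q i) (x i))⟩_{2L+1,β} ≤ exp(B·#T)` — VERBATIM the
  `hEMQ` sentence at the unit of record `uRec`, for the classical carrier `carrierCl C 1` (`= βR⁴·classicalResponse/C`);
* `CarrierExpMomentsSU2 := ∃ C B β₁ ℓ₁, 0 < C ∧ 0 < ℓ₁ ∧ CarrierExpMoments C B β₁ ℓ₁`.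

`GaussianDominationSU2 → CarrierExpMomentsSU2`, `PureSplitClSU2 → CarrierExpMomentsSU2 → ResponseMomentsOdd6SU2` and
`(CW) → CarrierExpMomentsSU2 → DirichletRateSU2` are the sequel `…CarrierExpMomentsGlue`; the FIXED-SCALE RUNG (the sentence of `CarrierExpMoments`
at each fixed `R`, with `C_R = 24R⁴`, `B_R = 6(2R+4)⁴(81 + 6 log β/(2L+1))`, no `uRec` window needed) is `torusE_exp_two_mul_sum_carrierCl_le_fixedScale`
(p641905).  Larger `C` is WEAKER (the carrier is `∝ 1/C`, `carrierExpMoments_mono`), so one constant suffices for every consumer.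

HONEST FRAMING: a re-labelling of OPEN conditional content (a weakening of (GD) that the composition already tolerates); positing it asserts
nothing; nothing of E0′, NT or the gap; YM mass gap NOT proved; not Clay.
-/

noncomputable section

open Literature.MathematicalPhysics.QuantumLattice (fundamentalLatticeRep LGConfig)
open Summit.QuantumFields.YangMills.Cruxes.OSLegsFromFemtoAndGap.DlrCollarTransfer
open Summit.QuantumFields.YangMills.Cruxes.UVSeamRec

namespace Summit.QuantumFields.YangMills.Cruxes.UVSeamRec.ClassicalResponse

/-- **(EM_Q) at the unit of record** for the classical carrier with constant `C` and budget `B`: for `β ≥ β₁`, every odd torus `(ℤ/(2L+1))⁴`,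
`1 ≤ R`, `R·uRec β ≤ ℓ₁`, `4R+8 ≤ L`, every cyclically `2R+4`-separated family and every `T`,
`⟨exp(2 Σ_{i∈T} carrierCl C 1 β R (q i) (x i))⟩_{2L+1,β} ≤ exp(B·#T)` — verbatim the hypothesis `hEMQ` of `responseMoments_of_quadratic_and_influence`. -/
def CarrierExpMoments (C B β₁ ℓ₁ : ℝ) : Prop :=
  ∀ β : ℝ, β₁ ≤ β → ∀ (L n : ℕ) (q : Fin n → Fin 4 × Fin 4) (x : Fin n → (Fin 4 → ℤ)) (R : ℕ),
    (∀ i, (q i).1 < (q i).2) → 1 ≤ R → (R : ℝ) * Transport.uRec β ≤ ℓ₁ → 4 * R + 8 ≤ L →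
    (∀ i j : Fin n, i ≠ j → ∃ k : Fin 4,
      (2 * (R : ℤ) + 4) ≤ |((((x i k - x j k : ℤ) : ZMod (2 * L + 1))).valMinAbs : ℤ)|) →
    ∀ T : Finset (Fin n),
      torusE (Matrix.specialUnitaryGroup (Fin 2) ℂ) (fundamentalLatticeRep 2) β L
        (fun U => Real.exp (((2 : ℕ) : ℝ) * ∑ i ∈ T, carrierCl (fundamentalLatticeRep 2) C 1 β R (q i) (x i) U)) ≤
        Real.exp (B * T.card)

/-- **(EM_Q^∃) «carrier exponential moments»** — the weakened second measure-side binder of line `coldwall_pure`: SOME carrier constant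
`C > 0`, budget `B`, threshold `β₁` and physical size `ℓ₁ > 0` with `CarrierExpMoments C B β₁ ℓ₁`.  Implied by `GaussianDominationSU2`;
sufficient (with `PureSplitClSU2`) for `ResponseMomentsOdd6SU2` and (with (CW)) for `DirichletRateSU2` (sequel `…CarrierExpMomentsGlue`). -/
def CarrierExpMomentsSU2 : Prop :=
  ∃ (C B β₁ ℓ₁ : ℝ), 0 < C ∧ 0 < ℓ₁ ∧ CarrierExpMoments C B β₁ ℓ₁

end Summit.QuantumFields.YangMills.Cruxes.UVSeamRec.ClassicalResponse

end
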